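import Mathlib
import Summits.AnomalousDissipation.AnomalousDissipation.Theorems.SoloBlindSimultaneousMidgap

/-!
# Selection in the variable u = 1/h: admissible intervals and a descending sequence hitting them
(solo-blind, s52; paper §24.49(3) (H9‴), §24.49(7))

Kernel #91 (`simultaneous_midgap_of_small_radii`) gives, in every window of length `X`, a point at
distance `≥ r k` from every comb `a k + ℤ·d k`.  For the selection of admissible wavenumbers `n`
along the DISCRETE sequence `u_n = 1/h(n) ↓ 0` one needs an admissible INTERVAL and a hitting
lemma for slowly descending sequences.  Both are elementary:
* `admissible_interval`: with radii `≤ d k / (16 L)` there is `x ∈ [0, X]` such that every `y` with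
  `|y - x| ≤ ρ` (`ρ ≤ r k` for all `k`) is admissible with radii `r k` (apply #91 to radii `2 r k`);
* `antitone_seq_hits`: a sequence with decrements `≤ ε` from index `N` on, which eventually drops
  below every positive level, visits every interval `[b, b + ε]` with `0 < b`, `b + ε ≤ u N` (`ε ≥ 0`).
-/

namespace Summit.AnomalousDissipation.AnomalousDissipation.Theorems

/-- An admissible interval of half-width `ρ` in every window, for radii `≤ d_k/(16 L)`. -/
theorem admissible_interval {ι : Type*} [Fintype ι] (a d r : ι → ℝ) (X ρ : ℝ)
    (hX : 0 < X) (hL : 0 < Fintype.card ι) (hd : ∀ k, 0 < d k) (hdX : ∀ k, d k ≤ X)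
    (hr : ∀ k, 0 ≤ r k) (hrd : ∀ k, r k ≤ d k / (16 * Fintype.card ι)) (hρ : ∀ k, ρ ≤ r k) :
    ∃ x ∈ Set.Icc (0 : ℝ) X, ∀ y : ℝ, |y - x| ≤ ρ → ∀ k, ∀ m : ℤ, r k ≤ |y - (a k + m * d k)| := by
  have hL' : (0 : ℝ) < Fintype.card ι := by exact_mod_cast hL
  obtain ⟨x, hx, hadm⟩ := simultaneous_midgap_of_small_radii a d (fun k => 2 * r k) X hX hL hd hdX
    (fun k => by have := hr k; positivity)
    (fun k => by
      have h := hrd k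
      have hdk := hd k
      have : d k / (16 * Fintype.card ι) * 2 = d k / (8 * Fintype.card ι) := by
        field_simp; ring
      calc 2 * r k = r k * 2 := by ring
        _ ≤ d k / (16 * Fintype.card ι) * 2 := by gcongr
        _ = d k / (8 * Fintype.card ι) := this)
  refine ⟨x, hx, fun y hy k m => ?_⟩
  have h2 : 2 * r k ≤ |x - (a k + m * d k)| := hadm k m
  have htri : |x - (a k + m * d k)| ≤ |x - y| + |y - (a k + m * d k)| := by
    have := abs_sub_le x y (a k + m * d k); exact this
  have hxy : |x - y| ≤ ρ := by rw [abs_sub_comm]; exact hy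
  have hρk : ρ ≤ r k := hρ k
  linarith

/-- A slowly descending sequence that eventually drops below every positive level visits every
interval `[b, b + ε]` with `0 < b` and `b + ε ≤ u N`. -/
theorem antitone_seq_hits (u : ℕ → ℝ) (N : ℕ) (ε : ℝ) (hε : 0 ≤ ε)
    (hdec : ∀ n, N ≤ n → u n - u (n + 1) ≤ ε)
    (hlim : ∀ δ : ℝ, 0 < δ → ∃ n, N ≤ n ∧ u n < δ) :
    ∀ b : ℝ, 0 < b → b + ε ≤ u N → ∃ n, N ≤ n ∧ b ≤ u n ∧ u n ≤ b + ε := by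
  intro b hb hbN
  classical
  have hex : ∃ n, N ≤ n ∧ u n < b := hlim b hb
  let m := Nat.find hex
  have hm : N ≤ m ∧ u m < b := Nat.find_spec hex
  have hmin : ∀ n, n < m → ¬ (N ≤ n ∧ u n < b) := fun n hn => Nat.find_min hex hn
  have hmN : m ≠ N := by
    intro h
    have h1 : u N < b := by rw [← h]; exact hm.2
    linarith
  have hmgt : N < m := lt_of_le_of_ne hm.1 (Ne.symm hmN)
  obtain ⟨p, hp⟩ : ∃ p, m = p + 1 := ⟨m - 1, by omega⟩
  have hpN : N ≤ p := by omega
  have hpm : p < m := by omega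
  have hnot := hmin p hpm
  have hup : b ≤ u p := by
    by_contra hlt
    exact hnot ⟨hpN, lt_of_not_ge hlt⟩
  have hstep : u p - u (p + 1) ≤ ε := hdec p hpN
  refine ⟨p, hpN, hup, ?_⟩
  have : u (p + 1) < b := by rw [← hp]; exact hm.2
  linarith

end Summit.AnomalousDissipation.AnomalousDissipation.Theorems
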